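import Literature.Probability.RandomPlanarGeometry.ObliqueRBMWedgeFlow
import Literature.Probability.RandomPlanarGeometry.BrownianExitInterval
import Literature.Probability.Process.BrownianPair
import Literature.Probability.Process.ContinuousHitting
import HarnessLib

/-!
# The canonical obliquely reflected Brownian motion on the pair of Wiener spaces

Third layer of the proof of
`Literature.Probability.RandomPlanarGeometry.LawlerSchrammWerner2001_orbm_uniformHitting`
(`ObliqueRBMWedge.lean`). On the product `WienerPair` of two canonical Wiener spaces with the
product measure `wienerPair` (`Process/BrownianPair.lean`; both coordinates of
`Process.brownian` have everywhere-continuous paths and start at `0`), we build the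
**canonical model** of the obliquely reflected Brownian motion in the `π/3` wedge as the explicit
Skorokhod image (`ObliqueRBMWedgeSkorokhod.lean`, `ObliqueRBMWedgeFlow.lean`) of the planar
Brownian motion `β_t(ω) = B_t(ω₁) + i B_t(ω₂)`:

* `pairBM t ω = B_t(ω₁) + i B_t(ω₂)` — planar Brownian motion, continuous in `t` for EVERY `ω`;
* `canORBM t ω = β_t + ζ · sup_{s≤t}(−y(β_s))⁺ + sup_{s≤t}(−x(β_s))⁺` — the reflected path
  (`x = quadX`, `y = quadY`), with coordinates `canX = x(β) + sup(−x(β))⁺ ≥ 0`,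
  `canY = y(β) + sup(−y(β))⁺ ≥ 0`, hence valued in the closed wedge
  (`canORBM_mem_closedWedge`), continuous in `t`, measurable in `ω`, and measurable with respect
  to the past `σ(pairPast t)` of the pair (`measurable_comap_pairPast_canORBM`);
* `canLevel t ω = x + y` — the level of the cross-section through `canORBM t ω`, and
  `canHit N = exitTime canLevel (−1) N` — the hitting time of the opposite side
  `{x + y = N}` of the triangle of size `N` (a stopping time for the raw pair filtration);
* `ae_canHit_ne_top` — **the opposite side is reached almost surely** (`canLevel ≥ y(β) =
  (2/√3) B(ω₂)` and a Brownian motion exceeds every level a.s., by gambler's ruin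
  `RandomPlanarGeometry.measureReal_brownianExitRight`);
* `canLevel_canHit` — at the hitting time the level is `N`.

## References

* W. Werner, LNM 1840 (2004), Ch. 5 §5.1. [WernerStFlour2004]
* J. Dubédat, Ann. IHP 40 (2004), §2–3. [Dubedat2004]
-/

noncomputable section

open MeasureTheory ProbabilityTheory Complex Set Filter
open scoped NNReal Real Topology ENNReal

namespace Literature.Probability.RandomPlanarGeometry

open Literature.Probability.Process

/-! ### The planar Brownian motion of the pair space -/

/-- The **planar Brownian motion of the pair space**: `β_t(ω₁, ω₂) = B_t(ω₁) + i B_t(ω₂)` with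
`B = Process.brownian` the canonical Brownian motion (continuous paths, `B₀ = 0`, for every `ω`).
[folklore] -/
def pairBM (t : ℝ≥0) (ω : WienerPair) : ℂ :=
  (brownian t ω.1 : ℂ) + (brownian t ω.2 : ℂ) * I

/-- Auxiliary statement (`pairBM_re`). [folklore] -/
@[simp] theorem pairBM_re (t : ℝ≥0) (ω : WienerPair) : (pairBM t ω).re = brownian t ω.1 := by
  simp [pairBM]

/-- Auxiliary statement (`pairBM_im`). [folklore] -/
@[simp] theorem pairBM_im (t : ℝ≥0) (ω : WienerPair) : (pairBM t ω).im = brownian t ω.2 := by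
  simp [pairBM]

/-- `β₀ = 0`. [folklore] -/
@[simp] theorem pairBM_zero (ω : WienerPair) : pairBM 0 ω = 0 := by
  simp [pairBM]

/-- Every path of `β` is continuous. [folklore] -/
theorem continuous_pairBM (ω : WienerPair) : Continuous (pairBM · ω) := by
  unfold pairBM
  have h1 := continuous_brownian ω.1
  have h2 := continuous_brownian ω.2
  fun_prop

/-- Every marginal of `β` is measurable. [folklore] -/
theorem measurable_pairBM (t : ℝ≥0) : Measurable (pairBM t) := by
  unfold pairBM
  have h1 : Measurable fun ω : WienerPair ↦ brownian t ω.1 := (measurable_brownian t).comp measurable_fst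
  have h2 : Measurable fun ω : WienerPair ↦ brownian t ω.2 := (measurable_brownian t).comp measurable_snd
  fun_prop

/-- The coordinate paths `x(β)`, `y(β)` are continuous. [folklore] -/
theorem continuous_quadX_pairBM (ω : WienerPair) : Continuous fun t ↦ quadX (pairBM t ω) := by
  have : Continuous quadX := by unfold quadX; fun_prop
  exact this.comp (continuous_pairBM ω)

/-- The coordinate paths `x(β)`, `y(β)` are continuous. [folklore] -/
theorem continuous_quadY_pairBM (ω : WienerPair) : Continuous fun t ↦ quadY (pairBM t ω) := by
  have : Continuous quadY := by unfold quadY; fun_prop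
  exact this.comp (continuous_pairBM ω)

/-- `quadX`, `quadY` are measurable. [folklore] -/
theorem measurable_quadX : Measurable quadX := by unfold quadX; fun_prop

/-- `quadX`, `quadY` are measurable. [folklore] -/
theorem measurable_quadY : Measurable quadY := by unfold quadY; fun_prop

/-- `y(β_t) = (2/√3) B_t(ω₂)` depends on the second coordinate only. [folklore] -/
theorem quadY_pairBM (t : ℝ≥0) (ω : WienerPair) :
    quadY (pairBM t ω) = 2 * brownian t ω.2 / Real.sqrt 3 := by
  simp [quadY]

/-! ### The canonical reflected process -/

/-- The boundary term on the first side: `L¹_t = sup_{s ≤ t} (−y(β_s))⁺`. [folklore] -/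
def canL₁ (t : ℝ≥0) (ω : WienerPair) : ℝ := skorokhodBdry (fun s ↦ quadY (pairBM s ω)) t

/-- The boundary term on the second side: `L²_t = sup_{s ≤ t} (−x(β_s))⁺`. [folklore] -/
def canL₂ (t : ℝ≥0) (ω : WienerPair) : ℝ := skorokhodBdry (fun s ↦ quadX (pairBM s ω)) t

/-- **The canonical obliquely reflected Brownian motion** in the `π/3` wedge:
`Z_t = β_t + ζ L¹_t + L²_t`, the Skorokhod image of the planar Brownian motion of the pair space.
[cite: WernerStFlour2004, Ch. 5 §5.1] -/
def canORBM (t : ℝ≥0) (ω : WienerPair) : ℂ :=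
  pairBM t ω + dirSixty * ((canL₁ t ω : ℝ) : ℂ) + ((canL₂ t ω : ℝ) : ℂ)

/-- The first quadrant coordinate of `Z`: `x(Z_t) = x(β_t) + L²_t`. [folklore] -/
theorem quadX_canORBM (t : ℝ≥0) (ω : WienerPair) :
    quadX (canORBM t ω) = quadX (pairBM t ω) + canL₂ t ω := by
  rw [canORBM, quadX_add, quadX_add, quadX_ofReal, mul_comm, quadX_ofReal_mul_dirSixty, add_zero]

/-- The second quadrant coordinate of `Z`: `y(Z_t) = y(β_t) + L¹_t`. [folklore] -/
theorem quadY_canORBM (t : ℝ≥0) (ω : WienerPair) :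
    quadY (canORBM t ω) = quadY (pairBM t ω) + canL₁ t ω := by
  rw [canORBM, quadY_add, quadY_add, quadY_ofReal, mul_comm, quadY_ofReal_mul_dirSixty, add_zero]

/-- `x(Z_t) ≥ 0`. [folklore] -/
theorem quadX_canORBM_nonneg (t : ℝ≥0) (ω : WienerPair) : 0 ≤ quadX (canORBM t ω) := by
  rw [quadX_canORBM]
  have := neg_le_skorokhodBdry (continuous_quadX_pairBM ω) (le_refl t)
  unfold canL₂
  linarith

/-- `y(Z_t) ≥ 0`. [folklore] -/
theorem quadY_canORBM_nonneg (t : ℝ≥0) (ω : WienerPair) : 0 ≤ quadY (canORBM t ω) := by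
  rw [quadY_canORBM]
  have := neg_le_skorokhodBdry (continuous_quadY_pairBM ω) (le_refl t)
  unfold canL₁
  linarith

/-- A point with non-negative quadrant coordinates lies in the closed `π/3` wedge. [folklore] -/
theorem mem_closedWedge_of_quad_nonneg {z : ℂ} (hx : 0 ≤ quadX z) (hy : 0 ≤ quadY z) :
    z ∈ closedWedge (π / 3) := by
  have h3 : (0 : ℝ) < Real.sqrt 3 := by positivity
  have h3sq : Real.sqrt 3 ^ 2 = 3 := Real.sq_sqrt (by norm_num)
  have him : 0 ≤ z.im := by
    unfold quadY at hy
    have := mul_nonneg hy h3.le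
    rw [div_mul_cancel₀ _ h3.ne'] at this
    linarith
  -- `√3 re z ≥ im z`
  have hre : z.im ≤ Real.sqrt 3 * z.re := by
    unfold quadX at hx
    have := mul_nonneg hx h3.le
    rw [sub_mul, div_mul_cancel₀ _ h3.ne'] at this
    nlinarith
  refine ⟨‖z‖, arg z, norm_nonneg z, arg_nonneg_iff.2 him, ?_, ?_⟩
  · -- `arg z ≤ π/3`
    rcases eq_or_lt_of_le him with h0 | hpos
    · -- `im z = 0`, `re z ≥ 0`
      have hre0 : 0 ≤ z.re := by nlinarith
      rw [arg_eq_zero_iff.2 ⟨hre0, h0.symm⟩]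
      positivity
    · have hrepos : 0 < z.re := by nlinarith
      rw [arg_of_re_nonneg hrepos.le, Real.arcsin_le_iff_le_sin' ⟨?_, ?_⟩]
      · rw [Real.sin_pi_div_three, div_le_iff₀ (norm_pos_iff.2 ?_)]
        · -- `im z ≤ (√3/2) |z|`: square both sides
          have hn : ‖z‖ ^ 2 = z.re ^ 2 + z.im ^ 2 := by
            rw [Complex.sq_norm, Complex.normSq_apply]; ring
          have hnn : 0 ≤ ‖z‖ := norm_nonneg z
          have h1 : z.im ^ 2 ≤ (Real.sqrt 3 * z.re) ^ 2 := pow_le_pow_left₀ him hre 2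
          rw [mul_pow, h3sq] at h1
          rw [← pow_le_pow_iff_left₀ him (by positivity) two_ne_zero]
          nlinarith [hn, h3sq, h1]
        · intro hz; rw [hz] at hpos; simp at hpos
      · linarith [Real.pi_pos, neg_nonpos.2 Real.pi_pos.le]
      · linarith [Real.pi_pos]
  · exact (norm_mul_exp_arg_mul_I z).symm

/-- **`Z_t` lies in the closed wedge.** [folklore] -/
theorem canORBM_mem_closedWedge (t : ℝ≥0) (ω : WienerPair) : canORBM t ω ∈ closedWedge (π / 3) :=
  mem_closedWedge_of_quad_nonneg (quadX_canORBM_nonneg t ω) (quadY_canORBM_nonneg t ω)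

/-- `Z₀ = 0`. [folklore] -/
@[simp] theorem canORBM_zero (ω : WienerPair) : canORBM 0 ω = 0 := by
  have h1 : canL₁ 0 ω = 0 := skorokhodBdry_zero (continuous_quadY_pairBM ω) (by simp [quadY])
  have h2 : canL₂ 0 ω = 0 := skorokhodBdry_zero (continuous_quadX_pairBM ω) (by simp [quadX])
  simp [canORBM, h1, h2]

/-- Every path of `Z` is continuous. [folklore] -/
theorem continuous_canORBM (ω : WienerPair) : Continuous (canORBM · ω) := by
  unfold canORBM canL₁ canL₂
  have h0 := continuous_pairBM ω
  have h1 := continuous_skorokhodBdry (continuous_quadY_pairBM ω)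
  have h2 := continuous_skorokhodBdry (continuous_quadX_pairBM ω)
  fun_prop

/-- Every marginal of `Z` is measurable. [folklore] -/
theorem measurable_canORBM (t : ℝ≥0) : Measurable (canORBM t) := by
  unfold canORBM canL₁ canL₂
  have h0 := measurable_pairBM t
  have h1 : Measurable fun ω ↦ skorokhodBdry (fun s ↦ quadY (pairBM s ω)) t :=
    measurable_skorokhodBdry (X := fun s ω ↦ quadY (pairBM s ω))
      (fun s ↦ measurable_quadY.comp (measurable_pairBM s)) continuous_quadY_pairBM t
  have h2 : Measurable fun ω ↦ skorokhodBdry (fun s ↦ quadX (pairBM s ω)) t :=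
    measurable_skorokhodBdry (X := fun s ω ↦ quadX (pairBM s ω))
      (fun s ↦ measurable_quadX.comp (measurable_pairBM s)) continuous_quadX_pairBM t
  fun_prop

/-! ### Adaptedness to the past of the pair -/

/-- `β_r` is `σ(pairPast s)`-measurable for `r ≤ s`. [folklore] -/
theorem measurable_comap_pairPast_pairBM {r s : ℝ≥0} (hrs : r ≤ s) :
    Measurable[MeasurableSpace.comap (pairPast s) inferInstance] (pairBM r) := by
  have h1 : Measurable[MeasurableSpace.comap (pairPast s) inferInstance]
      fun ω : WienerPair ↦ brownian r ω.1 := by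
    have : (fun ω : WienerPair ↦ brownian r ω.1) = (fun p ↦ p.1 ⟨r, hrs⟩) ∘ pairPast s := by
      ext ω; rfl
    rw [this]
    exact ((measurable_pi_apply _).comp measurable_fst).comp (comap_measurable (pairPast s))
  have h2 : Measurable[MeasurableSpace.comap (pairPast s) inferInstance]
      fun ω : WienerPair ↦ brownian r ω.2 := by
    have : (fun ω : WienerPair ↦ brownian r ω.2) = (fun p ↦ p.2 ⟨r, hrs⟩) ∘ pairPast s := by
      ext ω; rfl
    rw [this]
    exact ((measurable_pi_apply _).comp measurable_snd).comp (comap_measurable (pairPast s))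
  unfold pairBM
  exact ((Complex.measurable_ofReal.comp h1).add
    ((Complex.measurable_ofReal.comp h2).mul measurable_const))

/-- The boundary terms at time `r ≤ s` are `σ(pairPast s)`-measurable. [folklore] -/
theorem measurable_comap_pairPast_canL₁ {r s : ℝ≥0} (hrs : r ≤ s) :
    Measurable[MeasurableSpace.comap (pairPast s) inferInstance] (canL₁ r) := by
  have : canL₁ r = fun ω ↦ skorokhodBdryDyad (fun u ↦ quadY (pairBM u ω)) r := by
    ext ω
    exact (skorokhodBdryDyad_eq (continuous_quadY_pairBM ω) r).symm
  rw [this]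
  refine Measurable.iSup fun p ↦ measurable_const.max (Measurable.neg ?_)
  exact measurable_quadY.comp (measurable_comap_pairPast_pairBM ((dyadTime_le r p.1 p.2).trans hrs))

/-- The boundary terms at time `r ≤ s` are `σ(pairPast s)`-measurable. [folklore] -/
theorem measurable_comap_pairPast_canL₂ {r s : ℝ≥0} (hrs : r ≤ s) :
    Measurable[MeasurableSpace.comap (pairPast s) inferInstance] (canL₂ r) := by
  have : canL₂ r = fun ω ↦ skorokhodBdryDyad (fun u ↦ quadX (pairBM u ω)) r := by
    ext ω
    exact (skorokhodBdryDyad_eq (continuous_quadX_pairBM ω) r).symm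
  rw [this]
  refine Measurable.iSup fun p ↦ measurable_const.max (Measurable.neg ?_)
  exact measurable_quadX.comp (measurable_comap_pairPast_pairBM ((dyadTime_le r p.1 p.2).trans hrs))

/-- **`Z_r` is `σ(pairPast s)`-measurable for `r ≤ s`** (the reflected process is adapted to the
raw filtration of the pair). [folklore] -/
theorem measurable_comap_pairPast_canORBM {r s : ℝ≥0} (hrs : r ≤ s) :
    Measurable[MeasurableSpace.comap (pairPast s) inferInstance] (canORBM r) := by
  unfold canORBM
  exact ((measurable_comap_pairPast_pairBM hrs).add
    (measurable_const.mul (Complex.measurable_ofReal.comp (measurable_comap_pairPast_canL₁ hrs)))).add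
    (Complex.measurable_ofReal.comp (measurable_comap_pairPast_canL₂ hrs))

/-! ### The level and the hitting time of the opposite side -/

/-- The **level** `x(Z_t) + y(Z_t)` of the cross-section `{x + y = const}` through `Z_t`.
[folklore] -/
def canLevel (t : ℝ≥0) (ω : WienerPair) : ℝ := quadX (canORBM t ω) + quadY (canORBM t ω)

/-- `canLevel 0 = 0`. [folklore] -/
@[simp] theorem canLevel_zero (ω : WienerPair) : canLevel 0 ω = 0 := by
  simp [canLevel, quadX, quadY]

/-- The level is non-negative. [folklore] -/
theorem canLevel_nonneg (t : ℝ≥0) (ω : WienerPair) : 0 ≤ canLevel t ω :=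
  add_nonneg (quadX_canORBM_nonneg t ω) (quadY_canORBM_nonneg t ω)

/-- The level dominates `y(β_t) = (2/√3) B_t(ω₂)`. [folklore] -/
theorem quadY_pairBM_le_canLevel (t : ℝ≥0) (ω : WienerPair) : quadY (pairBM t ω) ≤ canLevel t ω := by
  have h1 := quadX_canORBM_nonneg t ω
  have h2 : quadY (pairBM t ω) ≤ quadY (canORBM t ω) := by
    rw [quadY_canORBM]
    exact le_add_of_nonneg_right (skorokhodBdry_nonneg (continuous_quadY_pairBM ω) t)
  unfold canLevel
  linarith

/-- The level paths are continuous. [folklore] -/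
theorem continuous_canLevel (ω : WienerPair) : Continuous (canLevel · ω) := by
  unfold canLevel
  have h := continuous_canORBM ω
  have hx : Continuous quadX := by unfold quadX; fun_prop
  have hy : Continuous quadY := by unfold quadY; fun_prop
  exact (hx.comp h).add (hy.comp h)

/-- The level marginals are measurable. [folklore] -/
theorem measurable_canLevel (t : ℝ≥0) : Measurable (canLevel t) :=
  (measurable_quadX.comp (measurable_canORBM t)).add (measurable_quadY.comp (measurable_canORBM t))

/-- The level at time `r ≤ s` is `σ(pairPast s)`-measurable. [folklore] -/
theorem measurable_comap_pairPast_canLevel {r s : ℝ≥0} (hrs : r ≤ s) :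
    Measurable[MeasurableSpace.comap (pairPast s) inferInstance] (canLevel r) :=
  (measurable_quadX.comp (measurable_comap_pairPast_canORBM hrs)).add
    (measurable_quadY.comp (measurable_comap_pairPast_canORBM hrs))

/-- **The hitting time of the opposite side `{x + y = N}`** of the triangle of size `N`, as the
exit time of the level from `(−1, N)` (the level is `≥ 0`, so this is the first time the level
reaches `N`; `⊤` if never). [folklore] -/
def canHit (N : ℝ) : WienerPair → WithTop ℝ≥0 := exitTime canLevel (-1) N

/-- For `N > 0` the level starts inside `(−1, N)`. [folklore] -/
theorem canLevel_zero_mem_Ioo {N : ℝ} (hN : 0 < N) (ω : WienerPair) : canLevel 0 ω ∈ Ioo (-1) N := by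
  rw [canLevel_zero]; exact ⟨by norm_num, hN⟩

/-- Before the hitting time the level is `< N`. [folklore] -/
theorem canLevel_lt_of_coe_lt_canHit {N : ℝ} {t : ℝ≥0} {ω : WienerPair}
    (h : (t : WithTop ℝ≥0) < canHit N ω) : canLevel t ω < N :=
  (mem_Ioo_of_coe_lt_exitTime h).2

/-- **At the (finite) hitting time the level equals `N`.** [folklore] -/
theorem canLevel_canHit {N : ℝ} (hN : 0 < N) {ω : WienerPair} {T : ℝ≥0} (hT : canHit N ω = T) :
    canLevel T ω = N := by
  rcases apply_eq_or_eq_of_exitTime_eq_coe (continuous_canLevel ω) (canLevel_zero_mem_Ioo hN ω) hT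
    with h | h
  · have := canLevel_nonneg T ω
    rw [h] at this
    norm_num at this
  · exact h

/-- If the level is `≥ N` at time `t` then the side has been hit by time `t`. [folklore] -/
theorem canHit_le_of_le_canLevel {N : ℝ} {t : ℝ≥0} {ω : WienerPair} (h : N ≤ canLevel t ω) :
    canHit N ω ≤ t := by
  rw [canHit, exitTime_le_coe_iff (continuous_canLevel ω)]
  exact ⟨t, le_rfl, fun hmem ↦ (not_lt.2 h) hmem.2⟩

/-! ### A Brownian motion exceeds every level: the opposite side is reached a.s. -/

/-- **A Brownian motion exceeds every level almost surely**: for every `c`, a.e. canonical path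
has `B_t ≥ c` for some `t` (gambler's ruin: the probability of leaving `(a, c)` through `c` is
`−a/(c − a) → 1` as `a → −∞`). Durrett (2019), Thm. 7.5.3. [folklore] -/
theorem ae_exists_le_brownian (c : ℝ) :
    ∀ᵐ ω ∂preWienerMeasure, ∃ t : ℝ≥0, c ≤ brownian t ω := by
  haveI := isProbabilityMeasure_preWienerMeasure'
  rcases le_or_gt c 0 with hc | hc
  · exact ae_of_all _ fun ω ↦ ⟨0, by simp [hc]⟩
  rw [ae_iff]
  push Not
  -- `{∀ t, B_t < c} ⊆ (exit right of (a, c))ᶜ` for every `a < 0`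
  refine le_antisymm ?_ bot_le
  refine ENNReal.le_of_forall_pos_le_add fun ε hε _ ↦ ?_
  rw [zero_add]
  -- choose `a < 0` with `c/(c - a) ≤ ε`
  obtain ⟨a, ha, hac⟩ : ∃ a : ℝ, a < 0 ∧ c / (c - a) ≤ ε := by
    refine ⟨-(c / ε), by
      have : (0 : ℝ) < ε := by exact_mod_cast hε
      exact neg_neg_of_pos (div_pos hc this), ?_⟩
    have hε' : (0 : ℝ) < ε := by exact_mod_cast hε
    rw [div_le_iff₀ (by
      have : 0 < c / (ε : ℝ) := div_pos hc hε'
      linarith)]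
    have : c - -(c / ε) = c + c / ε := by ring
    rw [this, mul_add, mul_div_cancel₀ _ hε'.ne']
    nlinarith
  have hsub : {ω : ℝ≥0 → ℝ | ∀ t, brownian t ω < c} ⊆ (brownianExitRight a c)ᶜ := by
    intro ω hω hR
    obtain ⟨hfin, hval⟩ := hR
    obtain ⟨T, hT⟩ := WithTop.ne_top_iff_exists.1 hfin
    have h1 := brownianExitValue_of_eq_coe (a := a) (b := c) hT.symm
    rw [hval] at h1
    have := hω T
    rw [← h1] at this
    exact lt_irrefl _ this
  calc preWienerMeasure {ω | ∀ t, brownian t ω < c}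
      ≤ preWienerMeasure (brownianExitRight a c)ᶜ := measure_mono hsub
    _ = ENNReal.ofReal (1 - (-a / (c - a))) := by
        rw [prob_compl_eq_one_sub (measurableSet_brownianExitRight a c),
          ← ENNReal.ofReal_one, ← ofReal_measureReal (measure_ne_top _ _),
          measureReal_brownianExitRight ha hc, ENNReal.ofReal_sub _ (by
            exact div_nonneg (by linarith) (by linarith))]
    _ ≤ ε := by
        have hca : c - a ≠ 0 := (by linarith : (0 : ℝ) < c - a).ne'
        have : 1 - -a / (c - a) = c / (c - a) := by
          field_simp
          ring
        rw [this]
        exact ENNReal.ofReal_le_of_le_toReal (by simpa using hac)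

/-- **The opposite side is reached almost surely**: for `N > 0`, `canHit N < ⊤` a.e. (the level
dominates `(2/√3) B(ω₂)`, which exceeds `N` at some time a.s.). [folklore] -/
theorem ae_canHit_ne_top (N : ℝ) : ∀ᵐ ω ∂wienerPair, canHit N ω ≠ ⊤ := by
  haveI := isProbabilityMeasure_preWienerMeasure'
  have h2 : ∀ᵐ ω ∂wienerPair, ∃ t : ℝ≥0, Real.sqrt 3 / 2 * N ≤ brownian t ω.2 := by
    -- transfer the one-dimensional statement to the second factor of the product
    have h := ae_exists_le_brownian (Real.sqrt 3 / 2 * N)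
    rw [wienerPair]
    rw [ae_iff] at h ⊢
    have : {ω : WienerPair | ¬∃ t : ℝ≥0, Real.sqrt 3 / 2 * N ≤ brownian t ω.2} =
        (univ : Set (ℝ≥0 → ℝ)) ×ˢ {ω₂ : ℝ≥0 → ℝ | ¬∃ t : ℝ≥0, Real.sqrt 3 / 2 * N ≤ brownian t ω₂} := by
      ext ω; simp
    rw [this, Measure.prod_prod, h, mul_zero]
  filter_upwards [h2] with ω ⟨t, ht⟩
  have hlev : N ≤ canLevel t ω := by
    refine le_trans ?_ (quadY_pairBM_le_canLevel t ω)
    rw [quadY_pairBM, le_div_iff₀ (by positivity)]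
    have h3 : Real.sqrt 3 ^ 2 = 3 := Real.sq_sqrt (by norm_num)
    nlinarith [h3]
  exact ne_top_of_le_ne_top WithTop.coe_ne_top (canHit_le_of_le_canLevel hlev)

end Literature.Probability.RandomPlanarGeometry
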